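import Summits.ValiantsHypothesis.ValiantsHypothesis.Theorems.LacunarySymmetroidMatrixDescartesCensusTwoRowBoxLeafDescartes

/-!
# `MatrixDescartes` census — W4 boundary layer, kernel kit: TWO-ROW-BOX LEAF, part 1c — the PATTERN variant (free cross signs)

HONEST FRAMING — as in `…CensusTwoRowBoxLeaf` / `…TwoRowBoxLeafDescartes` (library file, engine-1 g26, offer O4/O5 continuation of
R1945 / R1950 / R1971 / R2112; item `DoorA26 = PosRootLawAt 2 6 19`, stmt-ValiantsHypothesis-19979, OPEN, typed, never asserted).  The
«(V) leaf» of HYBRID27 §1 bounds `#Z₊^{mult}(P)` for the two-row form `P = Σ_j A_j X^{a+d_j} − Σ_j B_j X^{b+d_j}` (`B₁ > 0`, other `B_j ≥ 0`)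
by the sign changes of the COLLECTED Wronskian `N(x) = Σ_{t<M} K_t x^{s_t}`.  Part 1b needed every `K_t ≠ 0` and the emitter had to decide
every sign; when the ν̃-box leaves a cross coefficient's sign UNDECIDED, engine-1 g25 split into `3^k` branch files.  This part removes the
split: for ANY weak sign pattern `τ : ℕ → Bool` of `K` (`K_t ≥ 0` where `τ t`, `K_t ≤ 0` where `¬τ t`; zero coefficients allowed, one
`K_{t₀} ≠ 0`) one has `#Z₊^{mult}(P) ≤ #{t < M−1 : τ t ≠ τ (t+1)} + 1`.  The emitter takes `τ t := decide (0 ≤ K_t)` at the undecided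
slots and checks the count over all `2^k` choices by `decide`, so a free-sign leaf is ONE theorem.
* `signVariations_rsum_le_changes` — Descartes' count against a weak pattern: `Var(Σ c_t X^{e_t}) ≤ #{t : τ t ≠ τ (t+1)}` (induction on the
  number of terms with Mathlib's `signVariations_eq_eraseLead_add_ite`, carrying the one-bit defect «leading sign opposite to the pattern»);
* `countP_posRoots_le_changes_add_one_of_XW` — core: quotient Rolle with multiplicity (`countP_posRoots_le_wronskian_add_one`) + `X·W = X^{a+b}·N`
  + Mathlib's `roots_countP_pos_le_signVariations` + the lemma above;
* `countP_posRoots_twoRow₂/₃/₄_le_changes_add_one` — the instances the leaf emitter calls (Euler's identity for `X·W` is `ring`, as in part 1b).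
Nothing here bounds `ζ_sym(2,6)`, decides `DoorA26`, or bears on `MatrixDescartes` (stmt-ValiantsHypothesis-18050) / `VP ≠ VNP`.

[folklore] Quotient Rolle + Euler's operator + Descartes' rule of signs (deleting coefficients never creates sign changes); no single source.
-/

-- `Summit.ValiantsHypothesis.ValiantsHypothesis.…` repeats a component by the D-0017 layout
-- (single-conjunct summit), which the `dupNamespace` linter flags; the name is mandated.
set_option linter.dupNamespace false

namespace Summit.ValiantsHypothesis.ValiantsHypothesis.Theorems.LacunarySymmetroidMatrixDescartes.Census

open Polynomial Finset
open scoped BigOperators Polynomial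

/-! ### Sign variations of a fewnomial against a weak sign pattern -/

/-- Degree bound for `Σ_{t<n} c_t X^{e_t}` (`e` strictly increasing, no non-vanishing assumed): `natDegree ≤ e (n − 1)`. [folklore] -/
theorem natDegree_rsum_le (n : ℕ) (e : ℕ → ℕ) (he : StrictMono e) (c : ℕ → ℝ) :
    (∑ t ∈ range n, C (c t) * X ^ (e t) : ℝ[X]).natDegree ≤ e (n - 1) := by
  rw [natDegree_le_iff_coeff_eq_zero]
  intro N hN
  apply coeff_rsum_eq_zero
  intro t ht hte
  have : e t ≤ e (n - 1) := he.monotone (by omega)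
  omega

/-- **Sign variations against a weak sign pattern (with the leading-sign defect).**  For `N = Σ_{t<n} c_t X^{e_t}`
(`e` strictly increasing; zero coefficients allowed) and a pattern `τ : ℕ → Bool` with `c_t ≥ 0` where `τ t = true` and
`c_t ≤ 0` where `τ t = false` (`t < n`), `Var(N) + δ ≤ #{t < n−1 : τ t ≠ τ (t+1)}`, where the defect `δ ∈ {0,1}` is `1` exactly
when the leading coefficient of `N` has the strict sign OPPOSITE to `τ (n−1)` (induction on `n` with Mathlib's
`signVariations_eq_eraseLead_add_ite`). [folklore] -/
theorem signVariations_rsum_add_defect_le_changes (e : ℕ → ℕ) (he : StrictMono e) :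
    ∀ (n : ℕ) (c : ℕ → ℝ) (τ : ℕ → Bool),
      (∀ t, t < n → τ t = true → 0 ≤ c t) → (∀ t, t < n → τ t = false → c t ≤ 0) →
      (∑ t ∈ range n, C (c t) * X ^ (e t) : ℝ[X]).signVariations
        + (if (τ (n - 1) = true ∧ (∑ t ∈ range n, C (c t) * X ^ (e t) : ℝ[X]).leadingCoeff < 0) ∨
              (τ (n - 1) = false ∧ 0 < (∑ t ∈ range n, C (c t) * X ^ (e t) : ℝ[X]).leadingCoeff) then 1 else 0)
        ≤ ∑ t ∈ range (n - 1), (if τ t = τ (t + 1) then 0 else 1) := by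
  intro n
  induction n with
  | zero => intro c τ _ _; simp
  | succ M ih =>
    intro c τ hpos hneg
    -- strict sign of a NON-ZERO top coefficient from the pattern
    have hsgn : c M ≠ 0 → (τ M = true ∧ 0 < c M) ∨ (τ M = false ∧ c M < 0) := by
      intro hcM
      cases hb : τ M
      · exact Or.inr ⟨rfl, lt_of_le_of_ne (hneg M (by omega) hb) hcM⟩
      · exact Or.inl ⟨rfl, lt_of_le_of_ne (hpos M (by omega) hb) (Ne.symm hcM)⟩
    rcases Nat.eq_zero_or_pos M with rfl | hM
    · -- one term: a monomial (possibly zero); no sign change, no defect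
      rw [zero_add, Finset.sum_range_one, Nat.sub_self, Finset.sum_range_zero, C_mul_X_pow_eq_monomial,
        signVariations_monomial, zero_add, leadingCoeff_monomial]
      rw [if_neg]
      rintro (⟨h1, h2⟩ | ⟨h1, h2⟩)
      · rcases hsgn h2.ne with ⟨_, h4⟩ | ⟨h3, _⟩
        · linarith
        · rw [h1] at h3; exact Bool.noConfusion h3
      · rcases hsgn h2.ne' with ⟨h3, _⟩ | ⟨_, h4⟩
        · rw [h1] at h3; exact Bool.noConfusion h3
        · linarith
    · obtain ⟨k, rfl⟩ : ∃ k, M = k + 1 := ⟨M - 1, by omega⟩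
      have ihM := ih c τ (fun t ht => hpos t (by omega)) (fun t ht => hneg t (by omega))
      rw [Nat.add_sub_cancel] at ihM
      rw [Finset.sum_range_succ (fun t => C (c t) * X ^ (e t)) (k + 1), Nat.add_sub_cancel,
        Finset.sum_range_succ (fun t => (if τ t = τ (t + 1) then 0 else 1)) k]
      set N : ℝ[X] := ∑ t ∈ range (k + 1), C (c t) * X ^ (e t) with hN
      have hV : N.signVariations ≤ ∑ t ∈ range k, (if τ t = τ (t + 1) then 0 else 1) :=
        le_trans (Nat.le_add_right _ _) ihM
      by_cases hcM : c (k + 1) = 0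
      · -- the top coefficient vanishes: same polynomial, pattern slot shifted
        have h0 : (C (c (k + 1)) * X ^ (e (k + 1)) : ℝ[X]) = 0 := by rw [hcM, C_0, zero_mul]
        rw [h0, add_zero]
        by_cases hτe : τ k = τ (k + 1)
        · rw [if_pos hτe, add_zero, ← hτe]; exact ihM
        · rw [if_neg hτe]
          have : (if (τ (k + 1) = true ∧ N.leadingCoeff < 0) ∨ (τ (k + 1) = false ∧ 0 < N.leadingCoeff) then 1 else 0)
              ≤ 1 := by
            split_ifs <;> omega
          omega
      · -- the top coefficient is the leading coefficient
        have hdegN : N.natDegree ≤ e k := by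
          have := natDegree_rsum_le (k + 1) e he c
          rwa [Nat.add_sub_cancel] at this
        have hlt : N.degree < (C (c (k + 1)) * X ^ (e (k + 1)) : ℝ[X]).degree := by
          rw [degree_C_mul_X_pow (e (k + 1)) hcM]
          calc N.degree ≤ (N.natDegree : WithBot ℕ) := degree_le_natDegree
            _ ≤ ((e k : ℕ) : WithBot ℕ) := by exact_mod_cast hdegN
            _ < ((e (k + 1) : ℕ) : WithBot ℕ) := by exact_mod_cast he (by omega)
        have hlead : (N + C (c (k + 1)) * X ^ (e (k + 1))).leadingCoeff = c (k + 1) := by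
          rw [leadingCoeff_add_of_degree_lt hlt, leadingCoeff_C_mul_X_pow]
        have herase : (N + C (c (k + 1)) * X ^ (e (k + 1))).eraseLead = N := by
          rw [eraseLead_add_of_degree_lt_right hlt, eraseLead_C_mul_X_pow, add_zero]
        have hne : N + C (c (k + 1)) * X ^ (e (k + 1)) ≠ 0 := by
          intro h
          have h2 := hlead
          rw [h, leadingCoeff_zero] at h2
          exact hcM h2.symm
        have hsg := hsgn hcM
        -- no defect at the top
        have hdef : (if (τ (k + 1) = true ∧ (N + C (c (k + 1)) * X ^ (e (k + 1))).leadingCoeff < 0) ∨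
            (τ (k + 1) = false ∧ 0 < (N + C (c (k + 1)) * X ^ (e (k + 1))).leadingCoeff) then 1 else 0) = 0 := by
          rw [hlead, if_neg]
          rintro (⟨h1, h2⟩ | ⟨h1, h2⟩)
          · rcases hsg with ⟨_, h4⟩ | ⟨h3, _⟩
            · linarith
            · rw [h1] at h3; exact Bool.noConfusion h3
          · rcases hsg with ⟨h3, _⟩ | ⟨_, h4⟩
            · rw [h1] at h3; exact Bool.noConfusion h3
            · linarith
        rw [hdef, add_zero, signVariations_eq_eraseLead_add_ite hne, herase, hlead]
        by_cases hite : SignType.sign (c (k + 1)) = -SignType.sign N.leadingCoeff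
        · rw [if_pos hite]
          -- then `N.leadingCoeff` is strictly opposite to `c (k+1)`, hence to `τ (k+1)`
          have hdis : (τ (k + 1) = true ∧ N.leadingCoeff < 0) ∨ (τ (k + 1) = false ∧ 0 < N.leadingCoeff) := by
            rcases hsg with ⟨h3, h4⟩ | ⟨h3, h4⟩
            · refine Or.inl ⟨h3, ?_⟩
              rw [sign_pos h4] at hite
              have h5 : SignType.sign N.leadingCoeff = -1 := by
                rw [← neg_neg (SignType.sign N.leadingCoeff), ← hite]
              exact sign_eq_neg_one_iff.mp h5
            · refine Or.inr ⟨h3, ?_⟩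
              rw [sign_neg h4] at hite
              have h5 : SignType.sign N.leadingCoeff = 1 := by
                rw [← neg_neg (SignType.sign N.leadingCoeff), ← hite]; decide
              exact sign_eq_one_iff.mp h5
          by_cases hτe : τ k = τ (k + 1)
          · rw [if_pos hτe, add_zero]
            rw [hτe, if_pos hdis] at ihM
            exact ihM
          · rw [if_neg hτe]; omega
        · rw [if_neg hite, add_zero]
          exact le_trans hV (Nat.le_add_right _ _)

/-- **Sign variations of a fewnomial against a weak sign pattern.**  For `N = Σ_{t<n} c_t X^{e_t}` (`e` strictly increasing; zero
coefficients allowed) and `τ : ℕ → Bool` with `c_t ≥ 0` where `τ t = true` and `c_t ≤ 0` where `τ t = false` (`t < n`):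
`Var(N) ≤ #{t < n−1 : τ t ≠ τ (t+1)}` — deleting coefficients never creates sign changes. [folklore] -/
theorem signVariations_rsum_le_changes (n : ℕ) (e : ℕ → ℕ) (he : StrictMono e) (c : ℕ → ℝ) (τ : ℕ → Bool)
    (hpos : ∀ t, t < n → τ t = true → 0 ≤ c t) (hneg : ∀ t, t < n → τ t = false → c t ≤ 0) :
    (∑ t ∈ range n, C (c t) * X ^ (e t) : ℝ[X]).signVariations ≤ ∑ t ∈ range (n - 1), (if τ t = τ (t + 1) then 0 else 1) :=
  le_trans (Nat.le_add_right _ _) (signVariations_rsum_add_defect_le_changes e he n c τ hpos hneg)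


/-! ### From the `X·W` identity to the pattern bound -/

/-- **Core of the pattern variant.**  Let `W = g·P′ − P·g′` with `g` zero-free on `(0,∞)`, and suppose Euler's identity
`(X·W)(x) = x^a x^b · Σ_{t<M} K_t x^{s_t}` holds for all real `x` (`s` strictly increasing on `range M`, some `K_{t₀} ≠ 0`, zero
coefficients allowed).  If `τ : ℕ → Bool` is a weak sign pattern of `K`, then `#Z₊^{mult}(P) ≤ #{t < M−1 : τ t ≠ τ (t+1)} + 1`:
quotient Rolle with multiplicity (`countP_posRoots_le_wronskian_add_one`), `X·W = X^{a+b}·N` as polynomials, Descartes' rule of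
signs for `N` (Mathlib), and `signVariations_rsum_le_changes`. [folklore] -/
theorem countP_posRoots_le_changes_add_one_of_XW (P g W : ℝ[X]) (a b : ℕ) (hWdef : W = g * derivative P - P * derivative g)
    (hg : ∀ x : ℝ, 0 < x → g.eval x ≠ 0)
    (M : ℕ) (K : ℕ → ℝ) (s : ℕ → ℕ) (hs : ∀ i j, i < j → j < M → s i < s j)
    (t₀ : ℕ) (ht₀ : t₀ < M) (hK₀ : K t₀ ≠ 0) (τ : ℕ → Bool)
    (hτp : ∀ t, t < M → τ t = true → 0 ≤ K t) (hτn : ∀ t, t < M → τ t = false → K t ≤ 0)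
    (hev : ∀ x : ℝ, ((X : ℝ[X]) * W).eval x = x ^ a * x ^ b * (∑ t ∈ range M, K t * x ^ (s t))) :
    P.roots.countP (fun x => 0 < x) ≤ (∑ t ∈ range (M - 1), (if τ t = τ (t + 1) then 0 else 1)) + 1 := by
  classical
  -- the strictly increasing extension of `s` to all of ℕ and the collected Wronskian `N`
  set s' : ℕ → ℕ := fun t => if t < M then s t else s (M - 1) + t with hs'_def
  have hs's : ∀ t, t < M → s' t = s t := by intro t ht; simp [hs'_def, ht]
  have hs'mono : StrictMono s' := by
    refine strictMono_nat_of_lt_succ fun t => ?_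
    by_cases h1 : t + 1 < M
    · rw [hs's t (by omega), hs's (t + 1) h1]; exact hs t (t + 1) (by omega) h1
    · by_cases h0 : t < M
      · have htM : t = M - 1 := by omega
        rw [hs's t h0]; simp only [hs'_def, if_neg h1]; rw [htM]; omega
      · simp only [hs'_def, if_neg h0, if_neg h1]; omega
  set N : ℝ[X] := ∑ t ∈ range M, C (K t) * X ^ (s' t) with hN_def
  have hNeval : ∀ x : ℝ, N.eval x = ∑ t ∈ range M, K t * x ^ (s t) := by
    intro x
    rw [hN_def, eval_finsetSum]
    refine Finset.sum_congr rfl fun t ht => ?_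
    rw [Finset.mem_range] at ht
    simp only [eval_mul, eval_C, eval_pow, eval_X, hs's t ht]
  have hN0 : N ≠ 0 := by
    intro h0
    have h1 := coeff_rsum_self s' hs'mono K ht₀
    rw [← hN_def, h0, coeff_zero] at h1
    exact hK₀ h1.symm
  -- `X·W = X^{a+b}·N` as polynomials (they agree at every real)
  have hXW : (X : ℝ[X]) * W = X ^ (a + b) * N := by
    apply Polynomial.funext
    intro x
    rw [hev x, eval_mul, eval_pow, eval_X, hNeval x, pow_add]
  have hW0 : W ≠ 0 := by
    intro h0
    have : (X : ℝ[X]) ^ (a + b) * N = 0 := by rw [← hXW, h0, mul_zero]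
    exact (mul_ne_zero (pow_ne_zero _ X_ne_zero) hN0) this
  have hWN : W.roots.countP (fun x => 0 < x) = N.roots.countP (fun x => 0 < x) := by
    have h1 := countP_posRoots_X_pow_mul W 1
    rw [pow_one, hXW] at h1
    rw [← h1, countP_posRoots_X_pow_mul N (a + b)]
  have main := countP_posRoots_le_wronskian_add_one P g W hWdef hW0 hg
  have hDes : N.roots.countP (fun x => 0 < x) ≤ N.signVariations := N.roots_countP_pos_le_signVariations
  have hSV := signVariations_rsum_le_changes M s' hs'mono K τ hτp hτn
  rw [← hN_def] at hSV
  rw [hWN] at main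
  calc P.roots.countP (fun x => 0 < x) ≤ N.roots.countP (fun x => 0 < x) + 1 := main
    _ ≤ N.signVariations + 1 := by omega
    _ ≤ _ := by omega

/-! ### The three instances used by the leaf emitter -/

/-- **Two-row box leaf, pattern variant, `m = 2` columns.**  With `P = Σ_j A_j X^{a+d_j} − Σ_j B_j X^{b+d_j}` (`B₁ > 0`, other
`B_j ≥ 0`), let the COLLECTED Wronskian be `N(x) = Σ_{t<M} K_t x^{s_t}` (`s` strictly increasing on `range M`, SOME
`K_{t₀} ≠ 0`, zero coefficients allowed) with `N(x) = Φ(x^{d₁},…)` for all real `x`, and let `τ : ℕ → Bool` be a weak sign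
pattern of `K` (`K_t ≥ 0` where `τ t`, `K_t ≤ 0` where `¬τ t`).  Then `#Z₊^{mult}(P) ≤ #{t < M−1 : τ t ≠ τ (t+1)} + 1`
(quotient Rolle + Euler + Descartes + `signVariations_rsum_le_changes`). [folklore] -/
theorem countP_posRoots_twoRow₂_le_changes_add_one (A₁ A₂ B₁ B₂ : ℝ) (a b d₁ d₂ : ℕ)
    (hB₁ : 0 < B₁) (hB₂ : 0 ≤ B₂)
    (M : ℕ) (K : ℕ → ℝ) (s : ℕ → ℕ) (hs : ∀ i j, i < j → j < M → s i < s j)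
    (t₀ : ℕ) (ht₀ : t₀ < M) (hK₀ : K t₀ ≠ 0) (τ : ℕ → Bool)
    (hτp : ∀ t, t < M → τ t = true → 0 ≤ K t) (hτn : ∀ t, t < M → τ t = false → K t ≤ 0)
    (hNW : ∀ x : ℝ, (∑ t ∈ range M, K t * x ^ (s t)) = A₁ * B₁ * ((a : ℝ) + d₁ - ((b : ℝ) + d₁)) * (x ^ d₁ * x ^ d₁) + A₁ * B₂ * ((a : ℝ) + d₁ - ((b : ℝ) + d₂)) * (x ^ d₁ * x ^ d₂) + A₂ * B₁ * ((a : ℝ) + d₂ - ((b : ℝ) + d₁)) * (x ^ d₂ * x ^ d₁) + A₂ * B₂ * ((a : ℝ) + d₂ - ((b : ℝ) + d₂)) * (x ^ d₂ * x ^ d₂)) :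
    (C A₁ * X ^ (a + d₁) + C A₂ * X ^ (a + d₂) - (C B₁ * X ^ (b + d₁) + C B₂ * X ^ (b + d₂)) : ℝ[X]).roots.countP (fun x => 0 < x)
      ≤ (∑ t ∈ range (M - 1), (if τ t = τ (t + 1) then 0 else 1)) + 1 := by
  classical
  set P : ℝ[X] := C A₁ * X ^ (a + d₁) + C A₂ * X ^ (a + d₂) - (C B₁ * X ^ (b + d₁) + C B₂ * X ^ (b + d₂)) with hP_def
  set g : ℝ[X] := (C B₁ * X ^ (b + d₁) + C B₂ * X ^ (b + d₂) : ℝ[X]) with hg_def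
  set W : ℝ[X] := g * derivative P - P * derivative g with hW_def
  have hXP : (X : ℝ[X]) * derivative P = C (A₁ * ((a + d₁ : ℕ) : ℝ)) * X ^ (a + d₁) + C (A₂ * ((a + d₂ : ℕ) : ℝ)) * X ^ (a + d₂) - (C (B₁ * ((b + d₁ : ℕ) : ℝ)) * X ^ (b + d₁) + C (B₂ * ((b + d₂ : ℕ) : ℝ)) * X ^ (b + d₂)) := by
    simp only [hP_def, hg_def, derivative_add, derivative_sub, mul_add, mul_sub, X_mul_derivative_C_mul_X_pow]
  have hXg : (X : ℝ[X]) * derivative g = C (B₁ * ((b + d₁ : ℕ) : ℝ)) * X ^ (b + d₁) + C (B₂ * ((b + d₂ : ℕ) : ℝ)) * X ^ (b + d₂) := by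
    simp only [hg_def, derivative_add, mul_add, X_mul_derivative_C_mul_X_pow]
  have hev : ∀ x : ℝ, ((X : ℝ[X]) * W).eval x = x ^ a * x ^ b * (A₁ * B₁ * ((a : ℝ) + d₁ - ((b : ℝ) + d₁)) * (x ^ d₁ * x ^ d₁) + A₁ * B₂ * ((a : ℝ) + d₁ - ((b : ℝ) + d₂)) * (x ^ d₁ * x ^ d₂) + A₂ * B₁ * ((a : ℝ) + d₂ - ((b : ℝ) + d₁)) * (x ^ d₂ * x ^ d₁) + A₂ * B₂ * ((a : ℝ) + d₂ - ((b : ℝ) + d₂)) * (x ^ d₂ * x ^ d₂)) := by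
    intro x
    have h2 : (X : ℝ[X]) * W = g * (X * derivative P) - P * (X * derivative g) := by rw [hW_def]; ring
    rw [h2, hXP, hXg, hP_def, hg_def]
    simp only [eval_add, eval_sub, eval_mul, eval_C, eval_pow, eval_X]
    push_cast
    ring
  have hgpos : ∀ x : ℝ, 0 < x → g.eval x ≠ 0 := by
    intro x hx
    have hx1 : 0 < B₁ * x ^ (b + d₁) := mul_pos hB₁ (pow_pos hx _)
    have hx2 : 0 ≤ B₂ * x ^ (b + d₂) := mul_nonneg hB₂ (pow_pos hx _).le
    have : 0 < g.eval x := by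
      rw [hg_def]
      simp only [eval_add, eval_mul, eval_C, eval_pow, eval_X]
      linarith
    exact this.ne'
  exact countP_posRoots_le_changes_add_one_of_XW P g W a b hW_def hgpos M K s hs t₀ ht₀ hK₀ τ hτp hτn
    (fun x => by rw [hev x, hNW x])

/-- **Two-row box leaf, pattern variant, `m = 3` columns.**  With `P = Σ_j A_j X^{a+d_j} − Σ_j B_j X^{b+d_j}` (`B₁ > 0`, other
`B_j ≥ 0`), let the COLLECTED Wronskian be `N(x) = Σ_{t<M} K_t x^{s_t}` (`s` strictly increasing on `range M`, SOME
`K_{t₀} ≠ 0`, zero coefficients allowed) with `N(x) = Φ(x^{d₁},…)` for all real `x`, and let `τ : ℕ → Bool` be a weak sign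
pattern of `K` (`K_t ≥ 0` where `τ t`, `K_t ≤ 0` where `¬τ t`).  Then `#Z₊^{mult}(P) ≤ #{t < M−1 : τ t ≠ τ (t+1)} + 1`
(quotient Rolle + Euler + Descartes + `signVariations_rsum_le_changes`). [folklore] -/
theorem countP_posRoots_twoRow₃_le_changes_add_one (A₁ A₂ A₃ B₁ B₂ B₃ : ℝ) (a b d₁ d₂ d₃ : ℕ)
    (hB₁ : 0 < B₁) (hB₂ : 0 ≤ B₂) (hB₃ : 0 ≤ B₃)
    (M : ℕ) (K : ℕ → ℝ) (s : ℕ → ℕ) (hs : ∀ i j, i < j → j < M → s i < s j)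
    (t₀ : ℕ) (ht₀ : t₀ < M) (hK₀ : K t₀ ≠ 0) (τ : ℕ → Bool)
    (hτp : ∀ t, t < M → τ t = true → 0 ≤ K t) (hτn : ∀ t, t < M → τ t = false → K t ≤ 0)
    (hNW : ∀ x : ℝ, (∑ t ∈ range M, K t * x ^ (s t)) = A₁ * B₁ * ((a : ℝ) + d₁ - ((b : ℝ) + d₁)) * (x ^ d₁ * x ^ d₁) + A₁ * B₂ * ((a : ℝ) + d₁ - ((b : ℝ) + d₂)) * (x ^ d₁ * x ^ d₂) + A₁ * B₃ * ((a : ℝ) + d₁ - ((b : ℝ) + d₃)) * (x ^ d₁ * x ^ d₃) + A₂ * B₁ * ((a : ℝ) + d₂ - ((b : ℝ) + d₁)) * (x ^ d₂ * x ^ d₁) + A₂ * B₂ * ((a : ℝ) + d₂ - ((b : ℝ) + d₂)) * (x ^ d₂ * x ^ d₂) + A₂ * B₃ * ((a : ℝ) + d₂ - ((b : ℝ) + d₃)) * (x ^ d₂ * x ^ d₃) + A₃ * B₁ * ((a : ℝ) + d₃ - ((b : ℝ) + d₁)) * (x ^ d₃ * x ^ d₁) + A₃ * B₂ * ((a : ℝ)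 + d₃ - ((b : ℝ) + d₂)) * (x ^ d₃ * x ^ d₂) + A₃ * B₃ * ((a : ℝ) + d₃ - ((b : ℝ) + d₃)) * (x ^ d₃ * x ^ d₃)) :
    (C A₁ * X ^ (a + d₁) + C A₂ * X ^ (a + d₂) + C A₃ * X ^ (a + d₃) - (C B₁ * X ^ (b + d₁) + C B₂ * X ^ (b + d₂) + C B₃ * X ^ (b + d₃)) : ℝ[X]).roots.countP (fun x => 0 < x)
      ≤ (∑ t ∈ range (M - 1), (if τ t = τ (t + 1) then 0 else 1)) + 1 := by
  classical
  set P : ℝ[X] := C A₁ * X ^ (a + d₁) + C A₂ * X ^ (a + d₂) + C A₃ * X ^ (a + d₃) - (C B₁ * X ^ (b + d₁) + C B₂ * X ^ (b + d₂) + C B₃ * X ^ (b + d₃)) with hP_def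
  set g : ℝ[X] := (C B₁ * X ^ (b + d₁) + C B₂ * X ^ (b + d₂) + C B₃ * X ^ (b + d₃) : ℝ[X]) with hg_def
  set W : ℝ[X] := g * derivative P - P * derivative g with hW_def
  have hXP : (X : ℝ[X]) * derivative P = C (A₁ * ((a + d₁ : ℕ) : ℝ)) * X ^ (a + d₁) + C (A₂ * ((a + d₂ : ℕ) : ℝ)) * X ^ (a + d₂) + C (A₃ * ((a + d₃ : ℕ) : ℝ)) * X ^ (a + d₃) - (C (B₁ * ((b + d₁ : ℕ) : ℝ)) * X ^ (b + d₁) + C (B₂ * ((b + d₂ : ℕ) : ℝ)) * X ^ (b + d₂) + C (B₃ * ((b + d₃ : ℕ) : ℝ)) * X ^ (b + d₃)) := by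
    simp only [hP_def, hg_def, derivative_add, derivative_sub, mul_add, mul_sub, X_mul_derivative_C_mul_X_pow]
  have hXg : (X : ℝ[X]) * derivative g = C (B₁ * ((b + d₁ : ℕ) : ℝ)) * X ^ (b + d₁) + C (B₂ * ((b + d₂ : ℕ) : ℝ)) * X ^ (b + d₂) + C (B₃ * ((b + d₃ : ℕ) : ℝ)) * X ^ (b + d₃) := by
    simp only [hg_def, derivative_add, mul_add, X_mul_derivative_C_mul_X_pow]
  have hev : ∀ x : ℝ, ((X : ℝ[X]) * W).eval x = x ^ a * x ^ b * (A₁ * B₁ * ((a : ℝ) + d₁ - ((b : ℝ) + d₁)) * (x ^ d₁ * x ^ d₁) + A₁ * B₂ * ((a : ℝ) + d₁ - ((b : ℝ) + d₂)) * (x ^ d₁ * x ^ d₂) + A₁ * B₃ * ((a : ℝ) + d₁ - ((b : ℝ) + d₃)) * (x ^ d₁ * x ^ d₃) + A₂ * B₁ * ((a : ℝ) + d₂ - ((b : ℝ) + d₁)) * (x ^ d₂ * x ^ d₁) + A₂ * B₂ * ((a : ℝ) + d₂ - ((b : ℝ) + d₂)) * (x ^ d₂ * x ^ d₂) + A₂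 * B₃ * ((a : ℝ) + d₂ - ((b : ℝ) + d₃)) * (x ^ d₂ * x ^ d₃) + A₃ * B₁ * ((a : ℝ) + d₃ - ((b : ℝ) + d₁)) * (x ^ d₃ * x ^ d₁) + A₃ * B₂ * ((a : ℝ) + d₃ - ((b : ℝ) + d₂)) * (x ^ d₃ * x ^ d₂) + A₃ * B₃ * ((a : ℝ) + d₃ - ((b : ℝ) + d₃)) * (x ^ d₃ * x ^ d₃)) := by
    intro x
    have h2 : (X : ℝ[X]) * W = g * (X * derivative P) - P * (X * derivative g) := by rw [hW_def]; ring
    rw [h2, hXP, hXg, hP_def, hg_def]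
    simp only [eval_add, eval_sub, eval_mul, eval_C, eval_pow, eval_X]
    push_cast
    ring
  have hgpos : ∀ x : ℝ, 0 < x → g.eval x ≠ 0 := by
    intro x hx
    have hx1 : 0 < B₁ * x ^ (b + d₁) := mul_pos hB₁ (pow_pos hx _)
    have hx2 : 0 ≤ B₂ * x ^ (b + d₂) := mul_nonneg hB₂ (pow_pos hx _).le
    have hx3 : 0 ≤ B₃ * x ^ (b + d₃) := mul_nonneg hB₃ (pow_pos hx _).le
    have : 0 < g.eval x := by
      rw [hg_def]
      simp only [eval_add, eval_mul, eval_C, eval_pow, eval_X]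
      linarith
    exact this.ne'
  exact countP_posRoots_le_changes_add_one_of_XW P g W a b hW_def hgpos M K s hs t₀ ht₀ hK₀ τ hτp hτn
    (fun x => by rw [hev x, hNW x])

/-- **Two-row box leaf, pattern variant, `m = 4` columns.**  With `P = Σ_j A_j X^{a+d_j} − Σ_j B_j X^{b+d_j}` (`B₁ > 0`, other
`B_j ≥ 0`), let the COLLECTED Wronskian be `N(x) = Σ_{t<M} K_t x^{s_t}` (`s` strictly increasing on `range M`, SOME
`K_{t₀} ≠ 0`, zero coefficients allowed) with `N(x) = Φ(x^{d₁},…)` for all real `x`, and let `τ : ℕ → Bool` be a weak sign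
pattern of `K` (`K_t ≥ 0` where `τ t`, `K_t ≤ 0` where `¬τ t`).  Then `#Z₊^{mult}(P) ≤ #{t < M−1 : τ t ≠ τ (t+1)} + 1`
(quotient Rolle + Euler + Descartes + `signVariations_rsum_le_changes`). [folklore] -/
theorem countP_posRoots_twoRow₄_le_changes_add_one (A₁ A₂ A₃ A₄ B₁ B₂ B₃ B₄ : ℝ) (a b d₁ d₂ d₃ d₄ : ℕ)
    (hB₁ : 0 < B₁) (hB₂ : 0 ≤ B₂) (hB₃ : 0 ≤ B₃) (hB₄ : 0 ≤ B₄)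
    (M : ℕ) (K : ℕ → ℝ) (s : ℕ → ℕ) (hs : ∀ i j, i < j → j < M → s i < s j)
    (t₀ : ℕ) (ht₀ : t₀ < M) (hK₀ : K t₀ ≠ 0) (τ : ℕ → Bool)
    (hτp : ∀ t, t < M → τ t = true → 0 ≤ K t) (hτn : ∀ t, t < M → τ t = false → K t ≤ 0)
    (hNW : ∀ x : ℝ, (∑ t ∈ range M, K t * x ^ (s t)) = A₁ * B₁ * ((a : ℝ) + d₁ - ((b : ℝ) + d₁)) * (x ^ d₁ * x ^ d₁) + A₁ * B₂ * ((a : ℝ) + d₁ - ((b : ℝ) + d₂)) * (x ^ d₁ * x ^ d₂) + A₁ * B₃ * ((a : ℝ) + d₁ - ((b : ℝ) + d₃)) * (x ^ d₁ * x ^ d₃) + A₁ * B₄ * ((a : ℝ) + d₁ - ((b : ℝ) + d₄)) * (x ^ d₁ * x ^ d₄) + A₂ * B₁ * ((a : ℝ) + d₂ - ((b : ℝ) + d₁)) * (x ^ d₂ * x ^ d₁) + A₂ * B₂ * ((a : ℝ) + d₂ - ((b : ℝ) + d₂)) * (x ^ d₂ * x ^ d₂) + A₂ * B₃ * ((a :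 ℝ) + d₂ - ((b : ℝ) + d₃)) * (x ^ d₂ * x ^ d₃) + A₂ * B₄ * ((a : ℝ) + d₂ - ((b : ℝ) + d₄)) * (x ^ d₂ * x ^ d₄) + A₃ * B₁ * ((a : ℝ) + d₃ - ((b : ℝ) + d₁)) * (x ^ d₃ * x ^ d₁) + A₃ * B₂ * ((a : ℝ) + d₃ - ((b : ℝ) + d₂)) * (x ^ d₃ * x ^ d₂) + A₃ * B₃ * ((a : ℝ) + d₃ - ((b : ℝ) + d₃)) * (x ^ d₃ * x ^ d₃) + A₃ * B₄ * ((a : ℝ) + d₃ - ((b : ℝ) + d₄)) * (x ^ d₃ * x ^ d₄) + A₄ * B₁ * ((a : ℝ) + d₄ - ((b : ℝ) + d₁)) * (x ^ d₄ * x ^ d₁) + A₄ * B₂ * ((a : ℝ) + d₄ - ((b : ℝ) + d₂)) * (x ^ d₄ * x ^ d₂) + A₄ * B₃ * ((a : ℝ) + d₄ - ((b : ℝ) + d₃)) * (x ^ d₄ * x ^ d₃) + A₄ * B₄ * ((a : ℝ) + d₄ - ((b : ℝ) + d₄)) * (x ^ d₄ * x ^ d₄)) :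
    (C A₁ * X ^ (a + d₁) + C A₂ * X ^ (a + d₂) + C A₃ * X ^ (a + d₃) + C A₄ * X ^ (a + d₄) - (C B₁ * X ^ (b + d₁) + C B₂ * X ^ (b + d₂) + C B₃ * X ^ (b + d₃) + C B₄ * X ^ (b + d₄)) : ℝ[X]).roots.countP (fun x => 0 < x)
      ≤ (∑ t ∈ range (M - 1), (if τ t = τ (t + 1) then 0 else 1)) + 1 := by
  classical
  set P : ℝ[X] := C A₁ * X ^ (a + d₁) + C A₂ * X ^ (a + d₂) + C A₃ * X ^ (a + d₃) + C A₄ * X ^ (a + d₄) - (C B₁ * X ^ (b + d₁) + C B₂ * X ^ (b + d₂) + C B₃ * X ^ (b + d₃) + C B₄ * X ^ (b + d₄)) with hP_def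
  set g : ℝ[X] := (C B₁ * X ^ (b + d₁) + C B₂ * X ^ (b + d₂) + C B₃ * X ^ (b + d₃) + C B₄ * X ^ (b + d₄) : ℝ[X]) with hg_def
  set W : ℝ[X] := g * derivative P - P * derivative g with hW_def
  have hXP : (X : ℝ[X]) * derivative P = C (A₁ * ((a + d₁ : ℕ) : ℝ)) * X ^ (a + d₁) + C (A₂ * ((a + d₂ : ℕ) : ℝ)) * X ^ (a + d₂) + C (A₃ * ((a + d₃ : ℕ) : ℝ)) * X ^ (a + d₃) + C (A₄ * ((a + d₄ : ℕ) : ℝ)) * X ^ (a + d₄) - (C (B₁ * ((b + d₁ : ℕ) : ℝ)) * X ^ (b + d₁) + C (B₂ * ((b + d₂ : ℕ) : ℝ)) * X ^ (b + d₂) + C (B₃ * ((b + d₃ : ℕ) : ℝ)) * X ^ (b + d₃) + C (B₄ * ((b + d₄ : ℕ) : ℝ)) * X ^ (b + d₄)) := by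
    simp only [hP_def, hg_def, derivative_add, derivative_sub, mul_add, mul_sub, X_mul_derivative_C_mul_X_pow]
  have hXg : (X : ℝ[X]) * derivative g = C (B₁ * ((b + d₁ : ℕ) : ℝ)) * X ^ (b + d₁) + C (B₂ * ((b + d₂ : ℕ) : ℝ)) * X ^ (b + d₂) + C (B₃ * ((b + d₃ : ℕ) : ℝ)) * X ^ (b + d₃) + C (B₄ * ((b + d₄ : ℕ) : ℝ)) * X ^ (b + d₄) := by
    simp only [hg_def, derivative_add, mul_add, X_mul_derivative_C_mul_X_pow]
  have hev : ∀ x : ℝ, ((X : ℝ[X]) * W).eval x = x ^ a * x ^ b * (A₁ * B₁ * ((a : ℝ) + d₁ - ((b : ℝ) + d₁)) * (x ^ d₁ * x ^ d₁) + A₁ * B₂ * ((a : ℝ) + d₁ - ((b : ℝ) + d₂)) * (x ^ d₁ * x ^ d₂) + A₁ * B₃ * ((a : ℝ) + d₁ - ((b : ℝ) + d₃)) * (x ^ d₁ * x ^ d₃) + A₁ * B₄ * ((a : ℝ) + d₁ - ((b : ℝ) + d₄)) * (x ^ d₁ * x ^ d₄) + A₂ * B₁ * ((a : ℝ) + d₂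 - ((b : ℝ) + d₁)) * (x ^ d₂ * x ^ d₁) + A₂ * B₂ * ((a : ℝ) + d₂ - ((b : ℝ) + d₂)) * (x ^ d₂ * x ^ d₂) + A₂ * B₃ * ((a : ℝ) + d₂ - ((b : ℝ) + d₃)) * (x ^ d₂ * x ^ d₃) + A₂ * B₄ * ((a : ℝ) + d₂ - ((b : ℝ) + d₄)) * (x ^ d₂ * x ^ d₄) + A₃ * B₁ * ((a : ℝ) + d₃ - ((b : ℝ) + d₁)) * (x ^ d₃ * x ^ d₁) + A₃ * B₂ * ((a : ℝ) + d₃ - ((b : ℝ) + d₂)) * (x ^ d₃ * x ^ d₂) + A₃ * B₃ * ((a : ℝ) + d₃ - ((b : ℝ) + d₃)) * (x ^ d₃ * x ^ d₃) + A₃ * B₄ * ((a : ℝ) + d₃ - ((b : ℝ) + d₄)) * (x ^ d₃ * x ^ d₄) + A₄ * B₁ * ((a : ℝ) + d₄ - ((b : ℝ) + d₁)) * (x ^ d₄ * x ^ d₁) + A₄ * B₂ * ((a : ℝ) + d₄ - ((b : ℝ) + d₂)) * (x ^ d₄ * x ^ d₂) + A₄ * B₃ * ((a : ℝ) + d₄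 - ((b : ℝ) + d₃)) * (x ^ d₄ * x ^ d₃) + A₄ * B₄ * ((a : ℝ) + d₄ - ((b : ℝ) + d₄)) * (x ^ d₄ * x ^ d₄)) := by
    intro x
    have h2 : (X : ℝ[X]) * W = g * (X * derivative P) - P * (X * derivative g) := by rw [hW_def]; ring
    rw [h2, hXP, hXg, hP_def, hg_def]
    simp only [eval_add, eval_sub, eval_mul, eval_C, eval_pow, eval_X]
    push_cast
    ring
  have hgpos : ∀ x : ℝ, 0 < x → g.eval x ≠ 0 := by
    intro x hx
    have hx1 : 0 < B₁ * x ^ (b + d₁) := mul_pos hB₁ (pow_pos hx _)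
    have hx2 : 0 ≤ B₂ * x ^ (b + d₂) := mul_nonneg hB₂ (pow_pos hx _).le
    have hx3 : 0 ≤ B₃ * x ^ (b + d₃) := mul_nonneg hB₃ (pow_pos hx _).le
    have hx4 : 0 ≤ B₄ * x ^ (b + d₄) := mul_nonneg hB₄ (pow_pos hx _).le
    have : 0 < g.eval x := by
      rw [hg_def]
      simp only [eval_add, eval_mul, eval_C, eval_pow, eval_X]
      linarith
    exact this.ne'
  exact countP_posRoots_le_changes_add_one_of_XW P g W a b hW_def hgpos M K s hs t₀ ht₀ hK₀ τ hτp hτn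
    (fun x => by rw [hev x, hNW x])

end Summit.ValiantsHypothesis.ValiantsHypothesis.Theorems.LacunarySymmetroidMatrixDescartes.Census
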